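import Mathlib.NumberTheory.Padics.ProperSpace
import Mathlib.Analysis.Normed.Module.FiniteDimension
import Mathlib.Topology.Algebra.Valued.NormedValued
import Mathlib.Topology.Algebra.Valued.ValuedField
import Mathlib.Topology.MetricSpace.Ultra.TotallySeparated
import Literature.AlgebraicGeometry.Frobenioids.PadicLocalRankOne
import Literature.AlgebraicGeometry.Frobenioids.PadicFrobenioidUnitGroups
import HarnessLib

/-!
# Frobenioids II, Thm. 1.2 (i), first sentence: `O_K^×` is a topologically finitely generated profinite
# group for `K` a finite extension of `ℚ_p` (PROOFS)

Mochizuki, *The geometry of Frobenioids II*, Kyushu J. Math. **62** (2008), §1, Thm. 1.2 (i) p. 9: "`C` is of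
unit-profinite type", i.e. ([FrdI] Def. 2.8 (i) p. 52) each `O^×(A)` "admits a profinite topology with
respect to which it is a topologically finitely generated profinite group"; "immediate from the definitions"
= `O^×(A) ≅ O_{K_A}^×` (`PadicFrobenioidUnitGroups.lean`) + the LOCAL-FIELD FACT proved here: for `K` finite
over `ℚ_p` (t4's unbundled `PadicFld.IsPadicLocal`: a finite `ℚ_p`-algebra structure along which the
valuative relation restricts to the `p`-adic one, `hc`), `O_K^×` with its `p`-adic topology is a compact,
Hausdorff, totally disconnected topological group with a finite subset generating a dense subgroup
[cite: MochizukiFrdII2008, Thm 1.2 (i) p.9] [cite: MochizukiFrdI2008, Def. 2.8(i) p.52].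
Proof: (1) `valuation K` has rank one and its real embedding normalised by `|p| = p⁻¹`
(`PadicLocalRankOne.lean`) makes `K` a normed `ℚ_p`-space for the valuation norm (`Valued.toNormedField`),
hence PROPER (`FiniteDimensional.proper`, `ℚ_p` locally compact): the unit sphere `O_K^×` is compact,
and Hausdorff / totally disconnected (ultrametric) / a topological group as a subspace of `K^×`.
(2) Topological finite generation by the elementary `p`-th power step: a subgroup `A ≤ O_K^×` approximating
every unit modulo `p^a`, `a ≥ 3`, approximates every unit modulo `p^{a+1}` (`u ≡ 1`: `w = 1 + (u-1)/p`
satisfies `w^p ≡ u mod p^{a+1}` as `p ∣ binom(p,k)`, and `w ≡ s mod p^a ⇒ w^p ≡ s^p mod p^{a+1}`); the base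
case is a finite subcover of the compact `O_K^×`. PROOF-ONLY file (seat abc-iut-L1-d10); no definitions.
-/

namespace Literature.AlgebraicGeometry.Frobenioids

namespace PadicFrd

open ValuativeRel NNReal Topology

universe u v

variable {p : ℕ} [hp : Fact p.Prime] {K : Type u} [Field K] [ValuativeRel K]


section Approximation

/-! ### The `p`-th power step -/

/-- `v((1+t)^p − (1 + p t)) ≤ v(p)^{b+2}` when `v(t) ≤ v(p)^b`, `b ≥ 2`: the terms `binom(p,m) t^m`,
`2 ≤ m ≤ p`, of the binomial expansion. [cite: MochizukiFrdII2008, Thm 1.2 (i) p.9] -/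
theorem valuation_one_add_pow_sub_le {t : K} {b : ℕ} (hb : 2 ≤ b)
    (hρ1 : valuation K (p : K) ≤ 1) (ht : valuation K t ≤ valuation K (p : K) ^ b) :
    valuation K ((1 + t) ^ p - (1 + (p : K) * t)) ≤ valuation K (p : K) ^ (b + 2) := by
  set ρ := valuation K (p : K) with hρ
  have ht1 : valuation K t ≤ 1 := ht.trans (pow_le_one' hρ1 _)
  have h2 : 2 ≤ p := hp.out.two_le
  set f : ℕ → K := fun m => t ^ m * 1 ^ (p - m) * (Nat.choose p m : K) with hf
  have hsum : (1 + t) ^ p = (∑ i ∈ Finset.range (p - 1), f (i + 2)) + (1 + (p : K) * t) := by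
    rw [add_comm (1 : K) t, add_pow, Finset.sum_range_succ']
    have h := Finset.sum_range_succ' (fun i => f (i + 1)) (p - 1)
    rw [Nat.sub_add_cancel hp.out.one_le] at h
    rw [h]
    simp only [hf, pow_zero, one_pow, mul_one, Nat.choose_zero_right, Nat.cast_one, zero_add, pow_one,
      Nat.choose_one_right]
    ring
  rw [hsum, add_sub_cancel_right]
  apply Valuation.map_sum_le
  intro i hi
  rw [Finset.mem_range] at hi
  have hm : i + 2 ≤ p := by omega
  simp only [hf, one_pow, mul_one, map_mul, map_pow]
  have ht2 : valuation K t ^ (i + 2) ≤ ρ ^ (b * 2) := by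
    rw [pow_mul]
    exact (pow_le_pow_right_of_le_one' ht1 (by omega : 2 ≤ i + 2)).trans (pow_le_pow_left' ht 2)
  rcases hm.lt_or_eq with hlt | heq
  · calc valuation K t ^ (i + 2) * valuation K (Nat.choose p (i + 2) : K)
          ≤ ρ ^ (b * 2) * ρ := mul_le_mul' ht2 (valuation_choose_le (k := i + 2) (by omega) hlt)
      _ = ρ ^ (b * 2 + 1) := (pow_succ _ _).symm
      _ ≤ ρ ^ (b + 2) := pow_le_pow_right_of_le_one' hρ1 (by omega)
  · have hc1 : (Nat.choose p (i + 2) : K) = 1 := by rw [heq, Nat.choose_self, Nat.cast_one]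
    rw [hc1, map_one, mul_one]
    exact ht2.trans (pow_le_pow_right_of_le_one' hρ1 (by omega))

/-- `v(w^p − s^p) ≤ v(p)^{a+1}` when `v(w − s) ≤ v(p)^a`, `a ≥ 1`, `v(s) ≤ 1`.
[cite: MochizukiFrdII2008, Thm 1.2 (i) p.9] -/
theorem valuation_pow_sub_pow_le {w s : K} (hs : valuation K s ≤ 1) {a : ℕ} (ha : 1 ≤ a)
    (hρ1 : valuation K (p : K) ≤ 1) (h : valuation K (w - s) ≤ valuation K (p : K) ^ a) :
    valuation K (w ^ p - s ^ p) ≤ valuation K (p : K) ^ (a + 1) := by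
  set ρ := valuation K (p : K) with hρ
  set d := w - s with hd
  have hd1 : valuation K d ≤ 1 := h.trans (pow_le_one' hρ1 _)
  have hw : w = d + s := by rw [hd, sub_add_cancel]
  set g : ℕ → K := fun m => d ^ m * s ^ (p - m) * (Nat.choose p m : K) with hg
  have hsum : w ^ p = (∑ i ∈ Finset.range p, g (i + 1)) + s ^ p := by
    rw [hw, add_pow, Finset.sum_range_succ']
    simp only [hg, pow_zero, one_mul, Nat.sub_zero, Nat.choose_zero_right, Nat.cast_one, mul_one]
  rw [hsum, add_sub_cancel_right]
  apply Valuation.map_sum_le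
  intro i hi
  rw [Finset.mem_range] at hi
  simp only [hg, map_mul, map_pow]
  have hsp : valuation K s ^ (p - (i + 1)) ≤ 1 := pow_le_one' hs _
  rcases (show i + 1 ≤ p by omega).lt_or_eq with hlt | heq
  · calc valuation K d ^ (i + 1) * valuation K s ^ (p - (i + 1)) * valuation K (Nat.choose p (i + 1) : K)
          ≤ valuation K d * 1 * ρ :=
            mul_le_mul' (mul_le_mul' (pow_le_of_le_one zero_le hd1 (by omega)) hsp)
              (valuation_choose_le (k := i + 1) (by omega) hlt)
      _ ≤ ρ ^ a * 1 * ρ := mul_le_mul' (mul_le_mul' h le_rfl) le_rfl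
      _ = ρ ^ (a + 1) := by rw [mul_one, pow_succ]
  · rw [heq, Nat.choose_self, Nat.cast_one, map_one, mul_one, Nat.sub_self, pow_zero, mul_one]
    calc valuation K d ^ p ≤ valuation K d ^ 2 := pow_le_pow_right_of_le_one' hd1 hp.out.two_le
      _ ≤ (ρ ^ a) ^ 2 := pow_le_pow_left' h 2
      _ = ρ ^ (a * 2) := (pow_mul _ _ _).symm
      _ ≤ ρ ^ (a + 1) := pow_le_pow_right_of_le_one' hρ1 (by omega)

variable [Algebra ℚ_[p] K]

/-- **The `p`-th power step.** If a subgroup `A ≤ O_K^×` approximates every unit modulo `p^a` (`a ≥ 3`),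
it approximates every unit modulo `p^{a+1}`: for `u/s₁ = 1 + p t` put `w = 1 + t ∈ O_K^×`, `w ≡ s₂`; then
`u ≡ s₁ s₂^p`. [cite: MochizukiFrdII2008, Thm 1.2 (i) p.9] -/
theorem unitSubgroup_approx_succ (hρ : valuation K (p : K) < 1) {A : Subgroup Kˣ} (hA : A ≤ unitSubgroup K)
    {a : ℕ} (ha : 3 ≤ a)
    (h : ∀ u ∈ unitSubgroup K, ∃ s ∈ A, valuation K ((u : K) - s) ≤ valuation K (p : K) ^ a) :
    ∀ u ∈ unitSubgroup K, ∃ s ∈ A, valuation K ((u : K) - s) ≤ valuation K (p : K) ^ (a + 1) := by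
  set ρ := valuation K (p : K) with hρ_def
  have hp0 : (p : K) ≠ 0 := natCast_p_ne_zero
  have hρ0 : ρ ≠ 0 := (Valuation.ne_zero_iff _).mpr hp0
  have hρ1 : ρ ≤ 1 := hρ.le
  obtain ⟨b, rfl⟩ : ∃ b, a = b + 1 := ⟨a - 1, by omega⟩
  intro u hu
  obtain ⟨s₁, hs₁A, h₁⟩ := h u hu
  have hs₁ : valuation K (s₁ : K) = 1 := (mem_unitSubgroup_iff K).mp (hA hs₁A)
  have hs₁0 : (s₁ : K) ≠ 0 := s₁.ne_zero
  -- `u₁ = u / s₁ ≡ 1 mod p^a`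
  set u₁ : K := (u : K) * (s₁ : K)⁻¹ with hu₁_def
  have hu₁ : valuation K (u₁ - 1) ≤ ρ ^ (b + 1) := by
    have : u₁ - 1 = ((u : K) - s₁) * (s₁ : K)⁻¹ := by
      rw [sub_mul, mul_inv_cancel₀ hs₁0]
    rw [this, map_mul, map_inv₀, hs₁, inv_one, mul_one]
    exact h₁
  -- `t = (u₁ - 1)/p`, `v(t) ≤ v(p)^b`
  set t : K := (u₁ - 1) * (p : K)⁻¹ with ht_def
  have hpt : (p : K) * t = u₁ - 1 := by rw [mul_comm, ht_def, inv_mul_cancel_right₀ hp0]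
  have ht : valuation K t ≤ ρ ^ b := by
    have h' : valuation K (u₁ - 1) * ρ⁻¹ ≤ ρ ^ (b + 1) * ρ⁻¹ := mul_le_mul_left hu₁ _
    rw [pow_succ, mul_inv_cancel_right₀ hρ0] at h'
    rwa [ht_def, map_mul, map_inv₀]
  have ht1 : valuation K t < 1 :=
    ht.trans_lt (pow_lt_one₀ zero_le hρ (by omega))
  -- `w = 1 + t ∈ O_K^×`
  set w : K := 1 + t with hw_def
  have hw : valuation K w = 1 := Valuation.map_one_add_of_lt _ ht1
  have hw0 : w ≠ 0 := (Valuation.ne_zero_iff _).mp (by rw [hw]; exact one_ne_zero)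
  have hwU : Units.mk0 w hw0 ∈ unitSubgroup K := by rw [mem_unitSubgroup_iff]; exact hw
  obtain ⟨s₂, hs₂A, h₂⟩ := h _ hwU
  have hs₂ : valuation K (s₂ : K) = 1 := (mem_unitSubgroup_iff K).mp (hA hs₂A)
  change valuation K (w - s₂) ≤ ρ ^ (b + 1) at h₂
  -- `u ≡ s₁ s₂^p mod p^{a+1}`
  refine ⟨s₁ * s₂ ^ p, A.mul_mem hs₁A (A.pow_mem hs₂A p), ?_⟩
  have hB1 : valuation K (u₁ - w ^ p) ≤ ρ ^ (b + 2) := by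
    rw [← Valuation.map_neg, neg_sub, show u₁ = 1 + (p : K) * t by rw [hpt, add_sub_cancel]]
    exact valuation_one_add_pow_sub_le (by omega) hρ1 ht
  have hB2 : valuation K (w ^ p - (s₂ : K) ^ p) ≤ ρ ^ (b + 2) :=
    valuation_pow_sub_pow_le hs₂.le (by omega) hρ1 h₂
  have hfac : (u : K) - ((s₁ * s₂ ^ p : Kˣ) : K) = (s₁ : K) * ((u₁ - w ^ p) + (w ^ p - (s₂ : K) ^ p)) := by
    rw [Units.val_mul, Units.val_pow_eq_pow_val, hu₁_def]
    field_simp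
    ring
  rw [hfac, map_mul, hs₁, one_mul]
  exact (Valuation.map_add _ _ _).trans (max_le hB1 hB2)

/-- Iterating: a subgroup `A ≤ O_K^×` approximating every unit modulo `p^3` approximates every unit
modulo every power of `p`, i.e. is dense. [cite: MochizukiFrdII2008, Thm 1.2 (i) p.9] -/
theorem unitSubgroup_approx_all (hρ : valuation K (p : K) < 1) {A : Subgroup Kˣ} (hA : A ≤ unitSubgroup K)
    (h : ∀ u ∈ unitSubgroup K, ∃ s ∈ A, valuation K ((u : K) - s) ≤ valuation K (p : K) ^ 3) (n : ℕ) :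
    ∀ u ∈ unitSubgroup K, ∃ s ∈ A, valuation K ((u : K) - s) ≤ valuation K (p : K) ^ n := by
  have key : ∀ m, 3 ≤ m →
      ∀ u ∈ unitSubgroup K, ∃ s ∈ A, valuation K ((u : K) - s) ≤ valuation K (p : K) ^ m := by
    intro m hm
    induction m, hm using Nat.le_induction with
    | base => exact h
    | succ m hm ih => exact unitSubgroup_approx_succ hρ hA hm ih
  rcases le_or_gt n 3 with hn | hn
  · intro u hu
    obtain ⟨s, hsA, hs⟩ := h u hu
    exact ⟨s, hsA, hs.trans (pow_le_pow_right_of_le_one' hρ.le hn)⟩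
  · exact key n hn.le

end Approximation

section Topology

/-! ### The `p`-adic topology on `O_K^×` -/

variable [Algebra ℚ_[p] K]

/-- **[FrdII] Thm. 1.2 (i), first sentence — the local-field fact.** For `K` a finite extension of `ℚ_p`
(a finite `ℚ_p`-algebra structure along which the valuative relation restricts to the `p`-adic one), the
unit group `O_K^×` admits a profinite topology (the `p`-adic one) for which it is a topologically finitely
generated profinite group ([FrdI] Def. 2.8 (i)). [cite: MochizukiFrdII2008, Thm 1.2 (i) p.9] -/
theorem admitsTfgProfiniteTopology_unitSubgroup [Module.Finite ℚ_[p] K]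
    (hc : ∀ a b : ℚ_[p], algebraMap ℚ_[p] K a ≤ᵥ algebraMap ℚ_[p] K b ↔ a ≤ᵥ b) :
    AdmitsTfgProfiniteTopology (unitSubgroup K) := by
  obtain ⟨e, he⟩ := exists_rankLeOneStruct_normalized hc
  haveI : IsNontrivial K := isNontrivial_of_padic hc
  -- the valuation topology / norm on `K`, normalised so that it is a normed `ℚ_p`-space
  letI hV : Valued K (ValueGroupWithZero K) := Valued.mk' (valuation K)
  letI hr : (Valued.v : Valuation K (ValueGroupWithZero K)).RankOne :=
    Valuation.RankOne.ofRankLeOneStruct e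
  letI : NormedField K := Valued.toNormedField K (ValueGroupWithZero K)
  have hnorm : ∀ x : K, ‖x‖ = e.emb (valuation K x) := fun x => by
    change ((Valuation.RankOne.hom (valuation K) ((valuation K).restrict x) : ℝ≥0) : ℝ) = _
    rw [show Valuation.RankOne.hom (valuation K) = e.emb.comp MonoidWithZeroHom.ValueGroup₀.embedding
      from rfl, MonoidWithZeroHom.comp_apply, Valuation.embedding_restrict]
  letI : NormedSpace ℚ_[p] K :=
    { norm_smul_le := fun a x => by
        rw [Algebra.smul_def, norm_mul, hnorm (algebraMap ℚ_[p] K a), emb_valuation_algebraMap hc e he] }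
  haveI : ProperSpace K := FiniteDimensional.proper ℚ_[p] K
  -- the norm vs. the valuation
  have hp0 : (p : K) ≠ 0 := natCast_p_ne_zero
  have hρ1 : valuation K (p : K) < 1 := valuation_p_lt_one hc
  have hnp1 : ‖(p : K)‖ < 1 := Valued.toNormedField.norm_lt_one_iff.mpr hρ1
  have hnp0 : 0 < ‖(p : K)‖ := norm_pos_iff.mpr hp0
  have hle : ∀ (x : K) (n : ℕ),
      valuation K x ≤ valuation K (p : K) ^ n ↔ ‖x‖ ≤ ‖(p : K)‖ ^ n := fun x n => by
    rw [← norm_pow, Valued.toNormedField.norm_le_iff, map_pow]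
    exact Iff.rfl
  have hn1 : ∀ x : K, ‖x‖ = 1 ↔ valuation K x = 1 := fun x => by
    rw [hnorm, NNReal.coe_eq_one, ← map_one e.emb]
    exact e.strictMono.injective.eq_iff
  -- the embedding `O_K^× ↪ K`
  set ι : unitSubgroup K → K := fun u => ((u : Kˣ) : K) with hι_def
  have hι : IsEmbedding ι := Units.isEmbedding_val₀.comp IsEmbedding.subtypeVal
  -- compactness: `O_K^×` is the unit sphere of the proper space `K`
  have himage : ((↑) : Kˣ → K) '' (unitSubgroup K : Set Kˣ) = Metric.sphere (0 : K) 1 := by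
    ext x
    simp only [Set.mem_image, SetLike.mem_coe, mem_unitSubgroup_iff, mem_sphere_zero_iff_norm, hn1]
    constructor
    · rintro ⟨u, hu, rfl⟩
      exact hu
    · intro hx
      have hx0 : x ≠ 0 := (Valuation.ne_zero_iff _).mp (by rw [hx]; exact one_ne_zero)
      exact ⟨Units.mk0 x hx0, hx, rfl⟩
  have hcpt : IsCompact (unitSubgroup K : Set Kˣ) := by
    rw [Units.isEmbedding_val₀.isInducing.isCompact_iff, himage]
    exact isCompact_sphere 0 1
  have hK : CompactSpace (unitSubgroup K) := isCompact_iff_compactSpace.mp hcpt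
  -- total disconnectedness, inherited from the ultrametric `K` along the injection `ι`
  have htd : TotallyDisconnectedSpace (unitSubgroup K) :=
    ⟨isTotallyDisconnected_of_image hι.continuous.continuousOn hι.injective
      (isTotallyDisconnected_of_totallyDisconnectedSpace _)⟩
  -- a finite set `T` approximating every unit modulo `p^3` (finite subcover of the compact `O_K^×`)
  set r : ℝ := ‖(p : K)‖ ^ 3 with hr_def
  have hr0 : 0 < r := pow_pos hnp0 3
  set U : unitSubgroup K → Set (unitSubgroup K) := fun m => ι ⁻¹' Metric.ball (ι m) r with hU_def
  have hUo : ∀ m, IsOpen (U m) := fun m => Metric.isOpen_ball.preimage hι.continuous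
  have hUc : (Set.univ : Set (unitSubgroup K)) ⊆ ⋃ m, U m := fun m _ =>
    Set.mem_iUnion.mpr ⟨m, by simp [hU_def, hr0]⟩
  obtain ⟨T, hT⟩ := isCompact_univ.elim_finite_subcover U hUo hUc
  set A : Subgroup (unitSubgroup K) := Subgroup.closure (T : Set (unitSubgroup K)) with hA_def
  set A' : Subgroup Kˣ := A.map (unitSubgroup K).subtype with hA'_def
  have hA' : A' ≤ unitSubgroup K := Subgroup.map_subtype_le A
  have h3 : ∀ u ∈ unitSubgroup K, ∃ s ∈ A', valuation K ((u : K) - s) ≤ valuation K (p : K) ^ 3 := by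
    intro u hu
    obtain ⟨m, hmT, hm⟩ := Set.mem_iUnion₂.mp (hT (Set.mem_univ ⟨u, hu⟩))
    refine ⟨(m : Kˣ), ⟨m, Subgroup.subset_closure hmT, rfl⟩, ?_⟩
    rw [hU_def, Set.mem_preimage, Metric.mem_ball, dist_eq_norm] at hm
    exact (hle _ 3).mpr hm.le
  -- hence (the `p`-th power induction) modulo every power of `p`: `A` is dense
  have hall := unitSubgroup_approx_all hρ1 hA' h3
  refine ⟨inferInstance,
    { isTopologicalGroup := inferInstance
      compactSpace := hK
      t2Space := inferInstance
      totallyDisconnectedSpace := htd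
      exists_finset_dense := ⟨T, fun x => ?_⟩ }⟩
  rw [hι.closure_eq_preimage_closure_image, Set.mem_preimage, Metric.mem_closure_iff]
  intro ε hε
  obtain ⟨n, hn⟩ := exists_pow_lt_of_lt_one hε hnp1
  obtain ⟨s, ⟨m, hmA, rfl⟩, hs⟩ := hall n x x.2
  refine ⟨ι m, Set.mem_image_of_mem ι hmA, ?_⟩
  rw [dist_eq_norm]
  exact ((hle _ n).mp hs).trans_lt hn

/-- The same for an object of t4's base category `D₀ = PadicFld p` that "is a finite extension of `ℚ_p`"
(`PadicFld.IsPadicLocal`). [cite: MochizukiFrdII2008, Thm 1.2 (i) p.9] -/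
theorem PadicFld.admitsTfgProfiniteTopology_unitSubgroup (X : PadicFld.{u} p) (hX : X.IsPadicLocal) :
    AdmitsTfgProfiniteTopology (unitSubgroup X.K) := by
  obtain ⟨_, _, hc⟩ := hX.exists_finite
  exact PadicFrd.admitsTfgProfiniteTopology_unitSubgroup hc

end Topology

/-! ### Theorem 1.2 (i), first sentence, for the `p`-adic Frobenioid -/

namespace Datum

open CategoryTheory

variable {D : Type u} [Category.{v} D] (d : Datum D p)

/-- **[FrdII] Thm. 1.2 (i), first sentence: "`C` is of unit-profinite type"** — abc-iut-L1-t4's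
`Thm12_i_unitProfinite d`, UNCONDITIONALLY for every `p`-adic Frobenioid datum `d` (whose base objects are
finite extensions of `ℚ_p`, `d.isPadicLocal`): each `O^×(A) ≅ O_{K_A}^×` (`PadicFrobenioidUnitGroups`)
is a topologically finitely generated profinite group. [cite: MochizukiFrdII2008, Thm 1.2 (i) p.9] -/
theorem thm12_i_unitProfinite : Thm12_i_unitProfinite d :=
  d.thm12_i_unitProfinite_of fun A =>
    PadicFld.admitsTfgProfiniteTopology_unitSubgroup _ (d.isPadicLocal A)

end Datum

end PadicFrd

end Literature.AlgebraicGeometry.Frobenioids
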